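import Literature.NumberTheory.GaloisCohomology.Howard2004.TowerZModLeftKernelPairingProofs
import Literature.NumberTheory.GaloisCohomology.Howard2004.CasselsTateSkewPairingPrintIntended
import Summits.BirchSwinnertonDyer.BirchSwinnertonDyer.Theses.PrintX9
import Summits.BirchSwinnertonDyer.BirchSwinnertonDyer.Theses.PrintX10b
import Summits.BirchSwinnertonDyer.BirchSwinnertonDyer.Theorems.SchneiderFreeAdditiveX3PoitouTateShaDualityHolds
import Summits.BirchSwinnertonDyer.BirchSwinnertonDyer.Theorems.PoitouTateSelmerStructureDualityConjHolds
import Summits.BirchSwinnertonDyer.BirchSwinnertonDyer.Theorems.HowardThm161PrintIntendedOfProp141Intended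
import HarnessLib

set_option linter.dupNamespace false -- `…BirchSwinnertonDyer.BirchSwinnertonDyer…` is the cell's nested layout (D-0017)
set_option autoImplicit false

/-!
# Howard 2004 Prop. 1.4.1 / Thm. 1.4.2 PRINT-AS-INTENDED (the Flach leaf C45.1″) HOLDS — the route item
# `PrintX9.HowardFlachSkewPairingAtLevelIntended` (stmt-BirchSwinnertonDyer-24808) BY NAME, and Howard Thm. 1.6.1-as-intended
# (F-161′) UNCONDITIONALLY

Cell `run/shared/lean/pub/bsd-print-x9/` (D-0154 KEY row 10), seat `bsd-line-x10b-p1-w2` g19 on `bsd-line-x10b-p1` LEAD g14's GO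
(STATUS 2026-08-29T15:13:40Z «→ w2 g19: the SUMMITS-SIDE DISCHARGE»).  `--workitem stmt-BirchSwinnertonDyer-24808`.  THEOREMS ONLY.

WHAT THIS FILE DOES.  The cell's class-level port «C451-CL» of Flach's generalised Cassels–Tate pairing on Howard's level tower
(bricks Q0–Q7 by LEAD g14 and widths w2/w7/w8, 2026-08-29, all under `Literature/NumberTheory/GaloisCohomology/Howard2004/`) ends in
LEAD g14's `prop141_casselsTate_skewPairing_atLevel_printIntended_of_poitouTate : Automorphic.chebotarev_artinRep →
(∀ K, poitouTate_sha_tateDual K) → (∀ K, poitouTate_selmerStructure_duality_conj K) → prop141_casselsTate_skewPairing_atLevel_printIntended`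
— the print-as-intended leaf C45.1″ (Howard Prop. 1.4.1 with the displays of Thm. 1.4.2, `(k, n)`-version, under Howard's two standing
guards `(p : R) ≠ 0`, `p ∤ #𝓞_K^×`; lit g46 p722866, REF-177/178) from three NAMED inputs that are THEOREMS of the tree:
Čebotarev's density theorem for Artin representations (`Automorphic.chebotarev_artinRep_of_galoisSide`, Literature) and the two
Poitou–Tate dualities (`SchneiderFreeAdditiveX3.PoitouTateReduction.poitouTate_sha_tateDual_holds`,
`InputsPoitouTateSelmer.poitouTate_selmerStructure_duality_conj_holds`, Summits-side kernel theorems).  Hence, here: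
* `prop141_casselsTate_skewPairing_atLevel_printIntended_holds` — C45.1″ as a KERNEL THEOREM, no hypothesis;
* **`howardFlachSkewPairingAtLevelIntended_holds : Theses.PrintX9.HowardFlachSkewPairingAtLevelIntended`** — the route item
  stmt-BirchSwinnertonDyer-24808 (pen g16, PrintX9 rev 58; the binder `h141″` of the route's `closes` cone) BY NAME;
* `thm161_printIntended_holds : thm161_dvrKolyvaginBound_printIntended` — Howard's Thm. 1.6.1 AS INTENDED BY ITS PRINTED PROOF (F-161′,
  lit g45 p710086) UNCONDITIONALLY, through x10b-p1-w7 g12's Summits twin `HowardThm161PrintIntended.thm161_printIntended_of_prop141_printIntended`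
  (p724582) over the cell's G87 engine (closing file `Howard2004/Thm161PrintIntendedOfEngineBricks`, x10b-p1-w2 g17 p720105).

HONEST FRAMING.  What becomes unconditional here is Howard 2004's own §1 (Prop. 1.4.1 / Thm. 1.4.2 / Thm. 1.6.1, print-as-intended
readings) — published theorems re-proved in the tree («beyond-print theorem»: NO).  Howard's Thm. 1.6.1 AS WORDED (F-161,
`thm161_dvrKolyvaginBound`, item 23087) and C45.1′ AS WORDED (`prop141_casselsTate_skewPairing_atLevel`, stronger than print on the corner
`(p, d_K) = (3, −3)`, `n ≠ ∅`) are NOT proved; the other print leaves of rows 9/10 (CGLS Thm. 4.1.1 F-411, CGLS 4.1.3 / 5.1.3, Yan–Zhu 5.7,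
BCS 4.2.2, JSW 3.3.1, Cha Rmk. 25, Kolyvagin Thm. A) are untouched; no summit statement is proved by this seat; the Birch–Swinnerton-Dyer
conjecture is NOT proved by any of this.

References: [Howard2004HeegnerKolyvagin] B. Howard, *The Heegner point Kolyvagin system*, Compositio Math. **140** (2004) = arXiv:1202.6340,
Prop. 1.4.1, Thm. 1.4.2, Lemma 1.5.1, Thm. 1.6.1; [Flach1990] M. Flach, J. reine angew. Math. **412** (1990), Thm. 1–2; [MilneADT2006] Ch. I,
Thm. 4.10; [TateGCFT1967] §2.4 (Čebotarev).
-/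

namespace Summit.BirchSwinnertonDyer.BirchSwinnertonDyer.Theorems.HowardFlachSkewPairingIntended

open Literature.NumberTheory.GaloisCohomology
open Literature.NumberTheory.GaloisCohomology.Howard2004

/-- **C45.1″ — Howard 2004 Prop. 1.4.1 with the displays of Thm. 1.4.2, PRINT-AS-INTENDED — as a KERNEL THEOREM (no hypothesis)**:
LEAD g14's `prop141_casselsTate_skewPairing_atLevel_printIntended_of_poitouTate` (the class-level port of Flach's pairing on the level
tower, cell bricks Q0–Q7) fed with the tree's Čebotarev theorem for Artin representations and the two Poitou–Tate duality theorems
(`poitouTate_sha_tateDual_holds`, `poitouTate_selmerStructure_duality_conj_holds`).  A published theorem re-proved; not a case of BSD.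
[cite: Howard2004HeegnerKolyvagin, Prop. 1.4.1, Thm. 1.4.2 and Lemma 1.5.1 (arXiv:1202.6340 p0008 L83–L142, p0009 L127–133)]
[cite: Flach1990, Thm. 1 and Thm. 2] [cite: MilneADT2006, Ch. I, Thm. 4.10] [cite: TateGCFT1967, §2.4] -/
theorem prop141_casselsTate_skewPairing_atLevel_printIntended_holds :
    Literature.NumberTheory.GaloisCohomology.Howard2004.prop141_casselsTate_skewPairing_atLevel_printIntended :=
  prop141_casselsTate_skewPairing_atLevel_printIntended_of_poitouTate
    Literature.NumberTheory.Automorphic.chebotarev_artinRep_of_galoisSide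
    (fun K _ _ => SchneiderFreeAdditiveX3.PoitouTateReduction.poitouTate_sha_tateDual_holds K)
    (fun K _ _ => InputsPoitouTateSelmer.poitouTate_selmerStructure_duality_conj_holds K)

/-- **The route item `PrintX9.HowardFlachSkewPairingAtLevelIntended` (stmt-BirchSwinnertonDyer-24808) BY NAME** — its text is
`Howard2004.prop141_casselsTate_skewPairing_atLevel_printIntended` (C45.1″), now a kernel theorem
(`prop141_casselsTate_skewPairing_atLevel_printIntended_holds`).  The by-name print leaf of rows 9/10 that replaced Howard's Thm. 1.6.1
(F-161) is thereby DISCHARGED: the Howard side of the print routes carries no cite-only input any more.  Not a case of BSD.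
[cite: Howard2004HeegnerKolyvagin, Prop. 1.4.1 and Thm. 1.4.2 (arXiv:1202.6340 p0008 L83–L142)] [cite: Flach1990, Thm. 1 and Thm. 2] -/
theorem howardFlachSkewPairingAtLevelIntended_holds :
    Summit.BirchSwinnertonDyer.BirchSwinnertonDyer.Theses.PrintX9.HowardFlachSkewPairingAtLevelIntended := by
  unfold Summit.BirchSwinnertonDyer.BirchSwinnertonDyer.Theses.PrintX9.HowardFlachSkewPairingAtLevelIntended
  exact prop141_casselsTate_skewPairing_atLevel_printIntended_holds

/-- **Howard 2004 Thm. 1.6.1 AS INTENDED BY ITS PRINTED PROOF (F-161′, `thm161_dvrKolyvaginBound_printIntended`) — UNCONDITIONAL**: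
x10b-p1-w7 g12's Summits twin `HowardThm161PrintIntended.thm161_printIntended_of_prop141_printIntended : C45.1″ → F-161′` (over the cell's
G87 engine closing file `Howard2004/Thm161PrintIntendedOfEngineBricks`) applied to `prop141_casselsTate_skewPairing_atLevel_printIntended_holds`.
The AS-WORDED F-161 (`thm161_dvrKolyvaginBound`, item 23087) is NOT proved; not a case of BSD.
[cite: Howard2004HeegnerKolyvagin, Thm. 1.6.1 (arXiv:1202.6340 Thm. 2.6.1, p. 11 L17–32; print-as-intended scope p0004 L47–52, p0006 L84–92), Prop. 1.4.1, Thm. 1.4.2, Lemma 1.5.1]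
[cite: MilneADT2006, Ch. I, Thm. 4.10 (b)] -/
theorem thm161_printIntended_holds : thm161_dvrKolyvaginBound_printIntended :=
  HowardThm161PrintIntended.thm161_printIntended_of_prop141_printIntended
    prop141_casselsTate_skewPairing_atLevel_printIntended_holds

/-! ## §2 (append) The PrintX10b twin of the route item, after the pen's r8″ round on PrintX10b (rev 2026-08-29T15:44Z) -/

/-- **The route item `PrintX10b.HowardFlachSkewPairingAtLevelIntended` BY NAME** — the PrintX10b copy (pen g16's r8″ round on route
PrintX10b, 2026-08-29 15:41Z) of the SAME ledger item stmt-BirchSwinnertonDyer-24808 (shared by signature; already closed `proved` by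
`howardFlachSkewPairingAtLevelIntended_holds`); identical text `Howard2004.prop141_casselsTate_skewPairing_atLevel_printIntended` (C45.1″),
discharged by the kernel theorem `prop141_casselsTate_skewPairing_atLevel_printIntended_holds`.  Recorded so that the by-name audit of
row 10's `closes` cone finds the binder `h141″` proved at its literal PrintX10b type.  Not a case of BSD.
[cite: Howard2004HeegnerKolyvagin, Prop. 1.4.1 and Thm. 1.4.2 (arXiv:1202.6340 p0008 L83–L142)] [cite: Flach1990, Thm. 1 and Thm. 2] -/
theorem howardFlachSkewPairingAtLevelIntended_holds_X10b :
    Summit.BirchSwinnertonDyer.BirchSwinnertonDyer.Theses.PrintX10b.HowardFlachSkewPairingAtLevelIntended := by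
  unfold Summit.BirchSwinnertonDyer.BirchSwinnertonDyer.Theses.PrintX10b.HowardFlachSkewPairingAtLevelIntended
  exact prop141_casselsTate_skewPairing_atLevel_printIntended_holds

end Summit.BirchSwinnertonDyer.BirchSwinnertonDyer.Theorems.HowardFlachSkewPairingIntended
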